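/-
Copyright (c) 2026 the pub-hodgecm-mathlib formalisation cell (harness21).  Prover seat hodgecm-mathlib-K2E5-p10 (g4), Track B «K2-LIT» ∕ h413
(`stmt-HodgeConjecture-24833`), line `K2_E3_EllipticInputs`, unit U12, §L road «U-iso-T» brick (G⁺-b)/(K4-a): THE TRUNCATED QUADRATIC-CHARACTER CELL
INTEGRALS `B_n = ∫_{𝔭^β} χ̃(R σ)‖R σ‖⁻¹ 1[R σ ∉ 𝔭^{2n}] dσ` ARE EVENTUALLY CONSTANT IN `n` (`disc R ≠ 0`).  2026-09-04.
-/
import Summits.HodgeConjecture.HodgeConjecture.Theorems.K2E3LocalFieldQuadraticCharLocalisation   -- ★ (this seat): localisation at a simple root, two-shell cancellation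
import Summits.HodgeConjecture.HodgeConjecture.Theorems.K2E3LocalFieldQuadraticWeightElliptic      -- ★ p857429 (this seat): anisotropy `normAbs_sq_sub_ge_of_not_isSquare`
import HarnessLib

/-!
# K2_E3 road (h413), §L brick (G⁺-b)/(K4-a) — eventual constancy of the truncated quadratic-character cell integrals

Cell `pub/hodgecm-mathlib` (D-0151), Track B, seat K2E5-p10 (g4) (E3 §L line; dealer K2E3-plan (g3); (G⁺-b): line side K2E5-p17 (g3), `K`-side this seat).
`--supports stmt-HodgeConjecture-24833 --as helper`; THEOREMS ONLY (no definition ∕ instance ∕ notation ∕ named fact ∕ `sorry`); never imports `Cruxes/…/Lines`.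
COUNT-NEUTRAL.

For a quadratic character `χ ≠ 1` (`χ² = 1`, `χ̃ = Function.extend Units.val χ 0`), a ball `𝔭^β` and a polynomial `R(σ) = r₀ + r₁σ + r₂σ²` of degree `≤ 2` with
`disc R = r₁² − 4r₀r₂ ≠ 0` (the cell quadratics `P_X`, `Q_X` of ★ p857379 have `disc = disc χ_X`), the INCREMENTS of the truncated cell integrals
`B_n = ∫_{𝔭^β} 1[R σ ∉ 𝔭^{2n}] χ̃(R σ) ‖R σ‖⁻¹ dσ` are `Z_n = ∫_{𝔭^β} 1[R σ ∈ 𝔭^{2n} ∖ 𝔭^{2n+2}] χ̃(R σ)‖R σ‖⁻¹ dσ` (`setIntegral_truncWeight_succ`), and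
**`Z_n = 0` for all large `n`** (`exists_forall_annulusIncrement_eq_zero`), hence **`B_n = B_{n₀}` for `n ≥ n₀`** (`exists_forall_truncIntegral_eq`):
* ELLIPTIC (`r₂ ≠ 0`, `disc ∉ F²`): `‖R σ‖ ≥ ‖r₂‖‖2‖²‖Δ‖ > 0` (★ anisotropy), so the annulus `{R ∈ 𝔭^{2n} ∖ 𝔭^{2n+2}}` is eventually empty;
* SPLIT (`r₂ ≠ 0`, `disc = s²`): outside the two localisation balls `σᵢ + 𝔭^α` around the simple roots `‖R‖` is bounded below; inside, `R(σᵢ + v) = r₂·v·(±d + v)`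
  and the increment is the two-shell integral, which vanishes (★ `setIntegral_ball_rootFactor_twoShells_eq_zero`); the balls are inside `𝔭^β` or disjoint from it;
* LINEAR (`r₂ = 0`, `r₁ ≠ 0`): one root, `R(σ₁ + v) = r₁ v`, the increment is `χ̃(r₁)‖r₁‖⁻¹` times the two-shell integral (★ `setIntegral_twoShells_extend_mul_normInv_eq_zero`).
[HarishChandra1999AdmissibleDistributions, §7] [LabesseLanglands1979, §2]
HONEST LABEL: HC_CM is proved only modulo the 7 printed citations (2 remaining named inputs: hLiu418 = stmt-HodgeConjecture-24832, h413 =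
stmt-HodgeConjecture-24833) until rung 0 closes; count-neutral helper toward (LBU-2⁺)∕(G⁺-b), NOT ★.

## References
* [HarishChandra1999AdmissibleDistributions] Harish-Chandra (DeBacker–Sally), *Admissible Invariant Distributions on Reductive p-adic Groups* (1999), §7.
* [LabesseLanglands1979] J.-P. Labesse, R. P. Langlands, *L-indistinguishability for SL(2)*, Canad. J. Math. 31 (1979), §2.
-/

set_option autoImplicit false
set_option linter.dupNamespace false   -- `Summit.HodgeConjecture.HodgeConjecture.…` (D-0017 nested layout; lakefile exemption for Summits)

noncomputable section

open MeasureTheory Measure Filter Topology Set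
open scoped NNReal ENNReal Pointwise
open ValuativeRel
open Literature.NumberTheory.Automorphic Literature.NumberTheory.Automorphic.LocalFieldHaar Literature.NumberTheory.Automorphic.TateDirect
open Literature.NumberTheory.GaloisRepresentations Literature.NumberTheory.GaloisRepresentations.IsNonarchimedeanLocalField
open Summit.HodgeConjecture.HodgeConjecture.Cruxes.H413.K2E3LocalFieldSignCharZetaBalls
open Summit.HodgeConjecture.HodgeConjecture.Cruxes.H413.K2E3LocalFieldQuadraticCharSignWeight
open Summit.HodgeConjecture.HodgeConjecture.Cruxes.H413.K2E3LocalFieldQuadraticCharLocalisation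
open Summit.HodgeConjecture.HodgeConjecture.Cruxes.H413.K2E3LocalFieldQuadraticWeightElliptic

namespace Summit.HodgeConjecture.HodgeConjecture.Cruxes.H413.K2E3LocalFieldQuadraticWeightEventuallyConst

variable {F : Type*} [Field F] [ValuativeRel F] [TopologicalSpace F] [IsNonarchimedeanLocalField F]

/-! ## §1  Ball geometry -/

/-- **Nested-or-disjoint**: for `v ∈ 𝔭^α`, `α ≥ β`: `c + v ∈ 𝔭^β ↔ c ∈ 𝔭^β`. [folklore] -/
theorem add_mem_primePowBall_iff_of_mem {α β : ℤ} (hαβ : β ≤ α) {c v : F} (hv : v ∈ primePowBall F α) :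
    c + v ∈ primePowBall F β ↔ c ∈ primePowBall F β := by
  have hvβ : v ∈ primePowBall F β := primePowBall_antitone hαβ hv
  refine ⟨fun h => ?_, fun h => add_mem_primePowBall h hvβ⟩
  have := add_mem_primePowBall h (neg_mem_primePowBall hvβ)
  rwa [add_neg_cancel_right] at this

/-- Every positive real is eventually above `(q⁻¹)^{2n}`. [folklore] -/
theorem exists_forall_zpow_two_mul_lt {ε : ℝ≥0} (hε : 0 < ε) :
    ∃ N : ℕ, ∀ n : ℕ, N ≤ n → ((residueFieldCard F : ℝ≥0)⁻¹) ^ (2 * (n : ℤ)) < ε := by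
  obtain ⟨N, hN⟩ := exists_pow_lt_of_lt_one hε (inv_residueFieldCard_lt_one (F := F))
  refine ⟨N, fun n hn => lt_of_le_of_lt ?_ hN⟩
  rw [show (2 * (n : ℤ)) = ((2 * n : ℕ) : ℤ) by push_cast; ring, zpow_natCast]
  exact pow_le_pow_right_of_le_one' inv_residueFieldCard_lt_one.le (by omega)

section Main
variable [MeasurableSpace F] [BorelSpace F] (μ : Measure F) [μ.IsAddHaarMeasure]

/-! ## §2  The increment -/

omit [MeasurableSpace F] [BorelSpace F] in
/-- **The annulus weight is bounded**: `‖1[y ∈ 𝔭^a ∖ 𝔭^b] χ̃(y) ‖y‖⁻¹‖ ≤ q^b` (`χ² = 1`). [folklore] -/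
theorem norm_annulusWeight_le (χ : QuasiChar F) (hχ2 : ∀ u, χ u * χ u = 1) (a b : ℤ) (y : F) :
    ‖(primePowBall F a \ primePowBall F b).indicator
        (fun y => Function.extend ((↑) : Fˣ → F) (fun u => ((χ u : ℂˣ) : ℂ)) 0 y * ((((normAbs F y)⁻¹ : ℝ≥0) : ℝ) : ℂ)) y‖ ≤ (residueFieldCard F : ℝ) ^ b := by
  by_cases hy : y ∈ primePowBall F a \ primePowBall F b
  · rw [indicator_of_mem hy, norm_mul]
    calc _ ≤ 1 * (residueFieldCard F : ℝ) ^ b := mul_le_mul (norm_extend_le_one χ hχ2 y) (norm_normInv_le hy.2) (norm_nonneg _) zero_le_one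
      _ = _ := one_mul _
  · rw [indicator_of_notMem hy, norm_zero]; positivity

omit [MeasurableSpace F] [BorelSpace F] in
/-- **The complement weight is bounded**: `‖1[y ∉ 𝔭^b] χ̃(y) ‖y‖⁻¹‖ ≤ q^b` (`χ² = 1`). [folklore] -/
theorem norm_truncWeight_le (χ : QuasiChar F) (hχ2 : ∀ u, χ u * χ u = 1) (b : ℤ) (y : F) :
    ‖(primePowBall F b)ᶜ.indicator
        (fun y => Function.extend ((↑) : Fˣ → F) (fun u => ((χ u : ℂˣ) : ℂ)) 0 y * ((((normAbs F y)⁻¹ : ℝ≥0) : ℝ) : ℂ)) y‖ ≤ (residueFieldCard F : ℝ) ^ b := by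
  by_cases hy : y ∈ (primePowBall F b)ᶜ
  · rw [indicator_of_mem hy, norm_mul]
    calc _ ≤ 1 * (residueFieldCard F : ℝ) ^ b := mul_le_mul (norm_extend_le_one χ hχ2 y) (norm_normInv_le hy) (norm_nonneg _) zero_le_one
      _ = _ := one_mul _
  · rw [indicator_of_notMem hy, norm_zero]; positivity

/-- **The increment**: `B_{n+1} = B_n + Z_n` — on `𝔭^β`, `∫ 1[R ∉ 𝔭^{2n+2}]χ̃(R)‖R‖⁻¹ = ∫ 1[R ∉ 𝔭^{2n}]χ̃(R)‖R‖⁻¹ + ∫ 1[R ∈ 𝔭^{2n} ∖ 𝔭^{2n+2}]χ̃(R)‖R‖⁻¹` for any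
measurable `R : F → F`. [cite: HarishChandra1999AdmissibleDistributions, §7] -/
theorem setIntegral_truncWeight_succ (χ : QuasiChar F) (hχ2 : ∀ u, χ u * χ u = 1) (β : ℤ) {R : F → F} (hR : Measurable R) (n : ℕ) :
    ∫ σ in primePowBall F β, (primePowBall F (2 * ((n + 1 : ℕ) : ℤ)))ᶜ.indicator
        (fun y => Function.extend ((↑) : Fˣ → F) (fun u => ((χ u : ℂˣ) : ℂ)) 0 y * ((((normAbs F y)⁻¹ : ℝ≥0) : ℝ) : ℂ)) (R σ) ∂μ =
      ∫ σ in primePowBall F β, (primePowBall F (2 * (n : ℤ)))ᶜ.indicator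
        (fun y => Function.extend ((↑) : Fˣ → F) (fun u => ((χ u : ℂˣ) : ℂ)) 0 y * ((((normAbs F y)⁻¹ : ℝ≥0) : ℝ) : ℂ)) (R σ) ∂μ +
      ∫ σ in primePowBall F β, (primePowBall F (2 * (n : ℤ)) \ primePowBall F (2 * (n : ℤ) + 2)).indicator
        (fun y => Function.extend ((↑) : Fˣ → F) (fun u => ((χ u : ℂˣ) : ℂ)) 0 y * ((((normAbs F y)⁻¹ : ℝ≥0) : ℝ) : ℂ)) (R σ) ∂μ := by
  haveI : T2Space F := (isLocalField F).toT2Space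
  have hψ : Measurable fun y : F => Function.extend ((↑) : Fˣ → F) (fun u => ((χ u : ℂˣ) : ℂ)) 0 y * ((((normAbs F y)⁻¹ : ℝ≥0) : ℝ) : ℂ) :=
    (measurable_extend χ).mul measurable_normInv
  have hfin : μ (primePowBall F β) ≠ ⊤ := (isCompact_primePowBall β).measure_lt_top.ne
  have hpt : ∀ y : F, (primePowBall F (2 * ((n + 1 : ℕ) : ℤ)))ᶜ.indicator
      (fun y => Function.extend ((↑) : Fˣ → F) (fun u => ((χ u : ℂˣ) : ℂ)) 0 y * ((((normAbs F y)⁻¹ : ℝ≥0) : ℝ) : ℂ)) y =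
      (primePowBall F (2 * (n : ℤ)))ᶜ.indicator
        (fun y => Function.extend ((↑) : Fˣ → F) (fun u => ((χ u : ℂˣ) : ℂ)) 0 y * ((((normAbs F y)⁻¹ : ℝ≥0) : ℝ) : ℂ)) y +
      (primePowBall F (2 * (n : ℤ)) \ primePowBall F (2 * (n : ℤ) + 2)).indicator
        (fun y => Function.extend ((↑) : Fˣ → F) (fun u => ((χ u : ℂˣ) : ℂ)) 0 y * ((((normAbs F y)⁻¹ : ℝ≥0) : ℝ) : ℂ)) y := by
    intro y
    have h2n : (2 * ((n + 1 : ℕ) : ℤ)) = 2 * (n : ℤ) + 2 := by push_cast; ring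
    rw [h2n]
    by_cases h1 : y ∈ primePowBall F (2 * (n : ℤ) + 2)
    · have h0 : y ∈ primePowBall F (2 * (n : ℤ)) := primePowBall_antitone (by omega) h1
      rw [indicator_of_notMem (Set.notMem_compl_iff.2 h1), indicator_of_notMem (Set.notMem_compl_iff.2 h0), indicator_of_notMem (fun h => h.2 h1), add_zero]
    · by_cases h0 : y ∈ primePowBall F (2 * (n : ℤ))
      · rw [indicator_of_mem (show y ∈ (primePowBall F (2 * (n : ℤ) + 2))ᶜ from h1), indicator_of_notMem (Set.notMem_compl_iff.2 h0),
          indicator_of_mem (show y ∈ primePowBall F (2 * (n : ℤ)) \ primePowBall F (2 * (n : ℤ) + 2) from ⟨h0, h1⟩), zero_add]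
      · rw [indicator_of_mem (show y ∈ (primePowBall F (2 * (n : ℤ) + 2))ᶜ from h1), indicator_of_mem (show y ∈ (primePowBall F (2 * (n : ℤ)))ᶜ from h0),
          indicator_of_notMem (fun h => h0 h.1), add_zero]
  simp_rw [hpt]
  refine integral_add ?_ ?_
  · exact Measure.integrableOn_of_bounded hfin (((hψ.indicator (measurableSet_primePowBall _).compl).comp hR).aestronglyMeasurable)
      (Eventually.of_forall fun σ => norm_truncWeight_le χ hχ2 _ _)
  · exact Measure.integrableOn_of_bounded hfin
      (((hψ.indicator ((measurableSet_primePowBall _).diff (measurableSet_primePowBall _))).comp hR).aestronglyMeasurable)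
      (Eventually.of_forall fun σ => norm_annulusWeight_le χ hχ2 _ _ _)

/-! ## §3  Localisation of a ball integral inside `𝔭^β` -/

/-- **A translated ball inside `𝔭^β`**: for `α ≥ β`, `∫_{σ ∈ 𝔭^β} 1[σ − c ∈ 𝔭^α] g(σ) dσ = 1[c ∈ 𝔭^β] · ∫_{v ∈ 𝔭^α} g(c + v) dv` (the ball `c + 𝔭^α` is inside
`𝔭^β` or disjoint from it). [folklore] -/
theorem setIntegral_indicator_subBall_eq {α β : ℤ} (hαβ : β ≤ α) (c : F) (g : F → ℂ) :
    ∫ σ in primePowBall F β, {σ : F | σ - c ∈ primePowBall F α}.indicator g σ ∂μ =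
      (primePowBall F β).indicator (fun _ => (1 : ℂ)) c * ∫ v in primePowBall F α, g (c + v) ∂μ := by
  have hBm : MeasurableSet {σ : F | σ - c ∈ primePowBall F α} := (measurableSet_primePowBall α).preimage (measurable_id.sub_const c)
  rw [← integral_indicator (measurableSet_primePowBall β), indicator_indicator]
  by_cases hc : c ∈ primePowBall F β
  · have hcap : primePowBall F β ∩ {σ : F | σ - c ∈ primePowBall F α} = {σ : F | σ - c ∈ primePowBall F α} := by
      refine inter_eq_right.2 fun σ (hσ : σ - c ∈ primePowBall F α) => ?_
      have := (add_mem_primePowBall_iff_of_mem hαβ (c := c) hσ).2 hc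
      rwa [add_sub_cancel] at this
    rw [hcap, indicator_of_mem hc, one_mul, ← integral_indicator (measurableSet_primePowBall α),
      ← integral_add_left_eq_self (μ := μ) ({σ : F | σ - c ∈ primePowBall F α}.indicator g) c]
    refine integral_congr_ae (Eventually.of_forall fun v => ?_)
    simp only
    by_cases hv : v ∈ primePowBall F α
    · rw [indicator_of_mem (show c + v ∈ {σ : F | σ - c ∈ primePowBall F α} by simpa using hv), indicator_of_mem hv]
    · rw [indicator_of_notMem (show c + v ∉ {σ : F | σ - c ∈ primePowBall F α} by simpa using hv), indicator_of_notMem hv]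
  · have hcap : primePowBall F β ∩ {σ : F | σ - c ∈ primePowBall F α} = ∅ := by
      refine eq_empty_of_forall_notMem fun σ ⟨hσβ, (hσ : σ - c ∈ primePowBall F α)⟩ => hc ?_
      have := (add_mem_primePowBall_iff_of_mem hαβ (c := c) hσ).1 (by rwa [add_sub_cancel])
      exact this
    rw [hcap, indicator_empty, indicator_of_notMem hc, zero_mul, integral_zero]

/-! ## §4  The increments vanish eventually -/

/-- **THE INCREMENTS VANISH EVENTUALLY.**  For a quadratic character `χ ≠ 1` (`χ² = 1`), a ball `𝔭^β`, and `R(σ) = r₀ + r₁σ + r₂σ²` with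
`r₁² − 4 r₀ r₂ ≠ 0` (`char F ≠ 2`), there is `n₀` with `∫_{𝔭^β} 1[R σ ∈ 𝔭^{2n} ∖ 𝔭^{2n+2}] χ̃(R σ) ‖R σ‖⁻¹ dσ = 0` for all `n ≥ n₀`.
[cite: HarishChandra1999AdmissibleDistributions, §7] [cite: LabesseLanglands1979, §2] -/
theorem exists_forall_annulusIncrement_eq_zero (h2 : (2 : F) ≠ 0) (χ : QuasiChar F) (hχ2 : ∀ u, χ u * χ u = 1) (hχ1 : ∃ u, χ u ≠ 1)
    (β : ℤ) {r₀ r₁ r₂ : F} (hD : r₁ ^ 2 - 4 * r₀ * r₂ ≠ 0) :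
    ∃ n₀ : ℕ, ∀ n : ℕ, n₀ ≤ n →
      ∫ σ in primePowBall F β, (primePowBall F (2 * (n : ℤ)) \ primePowBall F (2 * (n : ℤ) + 2)).indicator
        (fun y => Function.extend ((↑) : Fˣ → F) (fun u => ((χ u : ℂˣ) : ℂ)) 0 y * ((((normAbs F y)⁻¹ : ℝ≥0) : ℝ) : ℂ)) (r₀ + r₁ * σ + r₂ * σ ^ 2) ∂μ = 0 := by
  haveI : T2Space F := (isLocalField F).toT2Space
  obtain ⟨e, he1, hce⟩ := exists_conductorBall χ
  have hq0 : (0 : ℝ≥0) < (residueFieldCard F : ℝ≥0)⁻¹ := inv_residueFieldCard_pos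
  -- abbreviation-free names for the weight
  have hann0 : ∀ (m : ℤ) (y : F), y ∉ primePowBall F m →
      (primePowBall F m \ primePowBall F (m + 2)).indicator
        (fun y => Function.extend ((↑) : Fˣ → F) (fun u => ((χ u : ℂˣ) : ℂ)) 0 y * ((((normAbs F y)⁻¹ : ℝ≥0) : ℝ) : ℂ)) y = 0 :=
    fun m y hy => indicator_of_notMem (fun h => hy h.1) _
  by_cases hr₂ : r₂ = 0
  · ----------------------------------------------------------------- LINEAR
    subst hr₂
    have hr₁ : r₁ ≠ 0 := by intro h; apply hD; rw [h]; ring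
    obtain ⟨w, hw⟩ := exists_normAbs_eq_inv_zpow hr₁
    set σ₁ : F := -r₀ / r₁ with hσ₁
    have hR : ∀ σ : F, r₀ + r₁ * σ + 0 * σ ^ 2 = r₁ * (σ - σ₁) := fun σ => by rw [hσ₁]; field_simp; ring
    refine ⟨(β + w).toNat, fun n hn => ?_⟩
    have hnβ : β ≤ 2 * (n : ℤ) - w := by have := Int.self_le_toNat (β + w); omega
    -- support of the integrand is inside the ball `σ₁ + 𝔭^{2n − w}`
    have hsupp : ∀ σ : F, (primePowBall F (2 * (n : ℤ)) \ primePowBall F (2 * (n : ℤ) + 2)).indicator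
        (fun y => Function.extend ((↑) : Fˣ → F) (fun u => ((χ u : ℂˣ) : ℂ)) 0 y * ((((normAbs F y)⁻¹ : ℝ≥0) : ℝ) : ℂ)) (r₀ + r₁ * σ + 0 * σ ^ 2) =
        {σ : F | σ - σ₁ ∈ primePowBall F (2 * (n : ℤ) - w)}.indicator (fun σ =>
          (primePowBall F (2 * (n : ℤ)) \ primePowBall F (2 * (n : ℤ) + 2)).indicator
            (fun y => Function.extend ((↑) : Fˣ → F) (fun u => ((χ u : ℂˣ) : ℂ)) 0 y * ((((normAbs F y)⁻¹ : ℝ≥0) : ℝ) : ℂ)) (r₁ * (σ - σ₁))) σ := by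
      intro σ
      rw [hR]
      by_cases hσ : σ ∈ {σ : F | σ - σ₁ ∈ primePowBall F (2 * (n : ℤ) - w)}
      · rw [indicator_of_mem hσ]
      · rw [indicator_of_notMem hσ]
        refine indicator_of_notMem (fun h => hσ ?_) _
        exact (mul_mem_primePowBall_iff hw).1 h.1
    rw [setIntegral_congr_fun (measurableSet_primePowBall β) (fun σ _ => hsupp σ), setIntegral_indicator_subBall_eq μ hnβ σ₁]
    -- the inner integral is `χ̃(r₁)‖r₁‖⁻¹` times the two-shell integral
    have hinner : ∫ v in primePowBall F (2 * (n : ℤ) - w), (primePowBall F (2 * (n : ℤ)) \ primePowBall F (2 * (n : ℤ) + 2)).indicator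
        (fun y => Function.extend ((↑) : Fˣ → F) (fun u => ((χ u : ℂˣ) : ℂ)) 0 y * ((((normAbs F y)⁻¹ : ℝ≥0) : ℝ) : ℂ)) (r₁ * (σ₁ + v - σ₁)) ∂μ =
        Function.extend ((↑) : Fˣ → F) (fun u => ((χ u : ℂˣ) : ℂ)) 0 r₁ * ((((normAbs F r₁)⁻¹ : ℝ≥0) : ℝ) : ℂ) *
          ∫ v in primePowBall F (2 * (n : ℤ) - w) \ primePowBall F (2 * (n : ℤ) - w + 2),
            Function.extend ((↑) : Fˣ → F) (fun u => ((χ u : ℂˣ) : ℂ)) 0 v * ((((normAbs F v)⁻¹ : ℝ≥0) : ℝ) : ℂ) ∂μ := by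
      have hpt : ∀ v : F, (primePowBall F (2 * (n : ℤ)) \ primePowBall F (2 * (n : ℤ) + 2)).indicator
          (fun y => Function.extend ((↑) : Fˣ → F) (fun u => ((χ u : ℂˣ) : ℂ)) 0 y * ((((normAbs F y)⁻¹ : ℝ≥0) : ℝ) : ℂ)) (r₁ * (σ₁ + v - σ₁)) =
          Function.extend ((↑) : Fˣ → F) (fun u => ((χ u : ℂˣ) : ℂ)) 0 r₁ * ((((normAbs F r₁)⁻¹ : ℝ≥0) : ℝ) : ℂ) *
            (primePowBall F (2 * (n : ℤ) - w) \ primePowBall F (2 * (n : ℤ) - w + 2)).indicator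
              (fun v => Function.extend ((↑) : Fˣ → F) (fun u => ((χ u : ℂˣ) : ℂ)) 0 v * ((((normAbs F v)⁻¹ : ℝ≥0) : ℝ) : ℂ)) v := by
        intro v
        rw [add_sub_cancel_left]
        have hmem : r₁ * v ∈ primePowBall F (2 * (n : ℤ)) \ primePowBall F (2 * (n : ℤ) + 2) ↔
            v ∈ primePowBall F (2 * (n : ℤ) - w) \ primePowBall F (2 * (n : ℤ) - w + 2) := by
          rw [Set.mem_sdiff, Set.mem_sdiff, mul_mem_primePowBall_iff hw, mul_mem_primePowBall_iff hw, show 2 * (n : ℤ) + 2 - w = 2 * (n : ℤ) - w + 2 by ring]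
        by_cases hv : v ∈ primePowBall F (2 * (n : ℤ) - w) \ primePowBall F (2 * (n : ℤ) - w + 2)
        · have hv0 : v ≠ 0 := fun h => hv.2 (h ▸ zero_mem_primePowBall _)
          rw [indicator_of_mem (hmem.2 hv), indicator_of_mem hv, extend_mul χ hr₁ hv0, map_mul, mul_inv, NNReal.coe_mul, Complex.ofReal_mul]
          ring
        · rw [indicator_of_notMem (fun h => hv (hmem.1 h)), indicator_of_notMem hv, mul_zero]
      simp_rw [hpt]
      rw [integral_const_mul, integral_indicator ((measurableSet_primePowBall _).diff (measurableSet_primePowBall _)),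
        Measure.restrict_restrict ((measurableSet_primePowBall _).diff (measurableSet_primePowBall _)),
        inter_eq_left.2 (fun v hv => hv.1)]
    rw [hinner, setIntegral_twoShells_extend_mul_normInv_eq_zero μ χ hχ2 hχ1, mul_zero, mul_zero]
  · by_cases hsq : IsSquare (r₁ ^ 2 - 4 * r₀ * r₂)
    · --------------------------------------------------------------- SPLIT
      obtain ⟨s, hs⟩ := hsq
      have hs0 : s ≠ 0 := by rintro rfl; exact hD (by rw [hs, mul_zero])
      set σ₁ : F := (-r₁ + s) / (2 * r₂) with hσ₁
      set σ₂ : F := (-r₁ - s) / (2 * r₂) with hσ₂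
      set d : F := σ₁ - σ₂ with hd
      have hdval : d = s / r₂ := by rw [hd, hσ₁, hσ₂]; field_simp; ring
      have hd0 : d ≠ 0 := by rw [hdval]; exact div_ne_zero hs0 hr₂
      have hR : ∀ σ : F, r₀ + r₁ * σ + r₂ * σ ^ 2 = r₂ * (σ - σ₁) * (σ - σ₂) := by
        intro σ; rw [hσ₁, hσ₂]; field_simp; linear_combination (-1 : F) * hs
      have hR1 : ∀ v : F, r₀ + r₁ * (σ₁ + v) + r₂ * (σ₁ + v) ^ 2 = r₂ * v * (d + v) := fun v => by rw [hR, hd]; ring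
      have hR2 : ∀ v : F, r₀ + r₁ * (σ₂ + v) + r₂ * (σ₂ + v) ^ 2 = r₂ * v * (-d + v) := fun v => by rw [hR, hd]; ring
      obtain ⟨w, hw⟩ := exists_normAbs_eq_inv_zpow (mul_ne_zero hr₂ hd0)
      have hw' : normAbs F (r₂ * -d) = ((residueFieldCard F : ℝ≥0)⁻¹) ^ w := by rw [mul_neg, normAbs_neg, hw]
      obtain ⟨k, hk⟩ := exists_normAbs_eq_inv_zpow hd0
      set α : ℤ := max (k + e) β with hαdef
      have hαβ : β ≤ α := le_max_right _ _
      have hα : ((residueFieldCard F : ℝ≥0)⁻¹) ^ α ≤ normAbs F d * ((residueFieldCard F : ℝ≥0)⁻¹) ^ (e : ℤ) := by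
        rw [hk, ← zpow_add₀ hq0.ne']
        exact zpow_le_zpow_right_of_le_one₀ hq0 inv_residueFieldCard_lt_one.le (le_max_left _ _)
      have hα' : ((residueFieldCard F : ℝ≥0)⁻¹) ^ α ≤ normAbs F (-d) * ((residueFieldCard F : ℝ≥0)⁻¹) ^ (e : ℤ) := by rwa [normAbs_neg]
      -- `n₀`: the annulus misses everything outside the two balls, and `α ≤ 2n − w`
      have hε : (0 : ℝ≥0) < normAbs F r₂ * (((residueFieldCard F : ℝ≥0)⁻¹) ^ α) ^ 2 :=
        mul_pos (pos_iff_ne_zero.2 ((map_ne_zero (normAbs F)).2 hr₂)) (pow_pos (zpow_pos hq0 α) 2)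
      obtain ⟨N, hN⟩ := exists_forall_zpow_two_mul_lt (F := F) hε
      refine ⟨max N (α + w).toNat, fun n hn => ?_⟩
      have hnN : N ≤ n := (le_max_left _ _).trans hn
      have hnα : α ≤ 2 * (n : ℤ) - w := by have := Int.self_le_toNat (α + w); have := (le_max_right N _).trans hn; omega
      -- pointwise: the integrand is the sum of its restrictions to the two balls
      have hpt : ∀ σ : F, (primePowBall F (2 * (n : ℤ)) \ primePowBall F (2 * (n : ℤ) + 2)).indicator
          (fun y => Function.extend ((↑) : Fˣ → F) (fun u => ((χ u : ℂˣ) : ℂ)) 0 y * ((((normAbs F y)⁻¹ : ℝ≥0) : ℝ) : ℂ)) (r₀ + r₁ * σ + r₂ * σ ^ 2) =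
          {σ : F | σ - σ₁ ∈ primePowBall F α}.indicator (fun σ => (primePowBall F (2 * (n : ℤ)) \ primePowBall F (2 * (n : ℤ) + 2)).indicator
            (fun y => Function.extend ((↑) : Fˣ → F) (fun u => ((χ u : ℂˣ) : ℂ)) 0 y * ((((normAbs F y)⁻¹ : ℝ≥0) : ℝ) : ℂ)) (r₀ + r₁ * σ + r₂ * σ ^ 2)) σ +
          {σ : F | σ - σ₂ ∈ primePowBall F α}.indicator (fun σ => (primePowBall F (2 * (n : ℤ)) \ primePowBall F (2 * (n : ℤ) + 2)).indicator
            (fun y => Function.extend ((↑) : Fˣ → F) (fun u => ((χ u : ℂˣ) : ℂ)) 0 y * ((((normAbs F y)⁻¹ : ℝ≥0) : ℝ) : ℂ)) (r₀ + r₁ * σ + r₂ * σ ^ 2)) σ := by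
        intro σ
        by_cases h1 : σ ∈ {σ : F | σ - σ₁ ∈ primePowBall F α}
        · -- then `σ ∉` the second ball (the balls are disjoint: `‖σ₁ − σ₂‖ = ‖d‖ > (q⁻¹)^α`)
          have h2 : σ ∉ {σ : F | σ - σ₂ ∈ primePowBall F α} := by
            intro h2
            have hdiff : d ∈ primePowBall F α := by
              have := add_mem_primePowBall (neg_mem_primePowBall h1) h2
              rw [show -(σ - σ₁) + (σ - σ₂) = d by rw [hd]; ring] at this
              exact this
            have hlt : ((residueFieldCard F : ℝ≥0)⁻¹) ^ α < normAbs F d := by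
              refine lt_of_le_of_lt hα ?_
              conv_rhs => rw [← mul_one (normAbs F d)]
              exact mul_lt_mul_of_pos_left (by rw [zpow_natCast]; exact pow_lt_one₀ bot_le inv_residueFieldCard_lt_one (by omega))
                (pos_iff_ne_zero.2 ((map_ne_zero (normAbs F)).2 hd0))
            exact not_le.2 hlt (mem_primePowBall_iff.1 hdiff)
          rw [indicator_of_mem h1, indicator_of_notMem h2, add_zero]
        · rw [indicator_of_notMem h1, zero_add]
          by_cases h2 : σ ∈ {σ : F | σ - σ₂ ∈ primePowBall F α}
          · rw [indicator_of_mem h2]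
          · rw [indicator_of_notMem h2]
            -- outside both balls `‖R σ‖ > (q⁻¹)^{2n}`
            refine hann0 _ _ fun hmem => ?_
            have hb1 : ((residueFieldCard F : ℝ≥0)⁻¹) ^ α < normAbs F (σ - σ₁) := not_le.1 (fun h => h1 (mem_primePowBall_iff.2 h))
            have hb2 : ((residueFieldCard F : ℝ≥0)⁻¹) ^ α < normAbs F (σ - σ₂) := not_le.1 (fun h => h2 (mem_primePowBall_iff.2 h))
            have hbig : normAbs F r₂ * (((residueFieldCard F : ℝ≥0)⁻¹) ^ α) ^ 2 < normAbs F (r₀ + r₁ * σ + r₂ * σ ^ 2) := by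
              rw [hR, map_mul, map_mul, pow_two, mul_assoc]
              exact mul_lt_mul_of_pos_left (mul_lt_mul hb1 hb2.le (zpow_pos hq0 α) (by positivity))
                (pos_iff_ne_zero.2 ((map_ne_zero (normAbs F)).2 hr₂))
            exact not_lt.2 (mem_primePowBall_iff.1 hmem) ((hN n hnN).trans hbig)
      rw [setIntegral_congr_fun (measurableSet_primePowBall β) (fun σ _ => hpt σ)]
      have hfin : μ (primePowBall F β) ≠ ⊤ := (isCompact_primePowBall β).measure_lt_top.ne
      have hψ : Measurable fun σ : F => (primePowBall F (2 * (n : ℤ)) \ primePowBall F (2 * (n : ℤ) + 2)).indicator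
          (fun y => Function.extend ((↑) : Fˣ → F) (fun u => ((χ u : ℂˣ) : ℂ)) 0 y * ((((normAbs F y)⁻¹ : ℝ≥0) : ℝ) : ℂ)) (r₀ + r₁ * σ + r₂ * σ ^ 2) := by
        refine (((measurable_extend χ).mul measurable_normInv).indicator ((measurableSet_primePowBall _).diff (measurableSet_primePowBall _))).comp ?_
        exact ((continuous_const.add (continuous_const.mul continuous_id)).add (continuous_const.mul (continuous_id.pow 2))).measurable
      have hint : ∀ c : F, IntegrableOn (fun σ => {σ : F | σ - c ∈ primePowBall F α}.indicator (fun σ =>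
          (primePowBall F (2 * (n : ℤ)) \ primePowBall F (2 * (n : ℤ) + 2)).indicator
            (fun y => Function.extend ((↑) : Fˣ → F) (fun u => ((χ u : ℂˣ) : ℂ)) 0 y * ((((normAbs F y)⁻¹ : ℝ≥0) : ℝ) : ℂ)) (r₀ + r₁ * σ + r₂ * σ ^ 2)) σ)
          (primePowBall F β) μ := by
        intro c
        refine Measure.integrableOn_of_bounded (M := (residueFieldCard F : ℝ) ^ (2 * (n : ℤ) + 2)) hfin
          ((hψ.indicator ((measurableSet_primePowBall α).preimage (measurable_id.sub_const c))).aestronglyMeasurable) (Eventually.of_forall fun σ => ?_)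
        refine (norm_indicator_le_norm_self _ _).trans ?_
        exact norm_annulusWeight_le χ hχ2 _ _ _
      rw [integral_add (hint σ₁) (hint σ₂), setIntegral_indicator_subBall_eq μ hαβ σ₁, setIntegral_indicator_subBall_eq μ hαβ σ₂]
      simp_rw [hR1, hR2]
      rw [setIntegral_ball_rootFactor_twoShells_eq_zero μ χ hχ2 hχ1 he1 hce hd0 hw hα hnα,
        setIntegral_ball_rootFactor_twoShells_eq_zero μ χ hχ2 hχ1 he1 hce (neg_ne_zero.2 hd0) hw' hα' hnα, mul_zero, mul_zero, add_zero]
    · --------------------------------------------------------------- ELLIPTIC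
      set u : F := -r₁ / (2 * r₂) with hu
      set Δ : F := (r₁ ^ 2 - 4 * r₀ * r₂) / (2 * r₂) ^ 2 with hΔ
      have hR : ∀ σ : F, r₀ + r₁ * σ + r₂ * σ ^ 2 = r₂ * ((σ - u) ^ 2 - Δ) := by
        intro σ; rw [hu, hΔ]; field_simp; ring
      have hΔsq : ¬ IsSquare Δ := by
        rintro ⟨t, ht⟩
        refine hsq ⟨2 * r₂ * t, ?_⟩
        have : r₁ ^ 2 - 4 * r₀ * r₂ = Δ * (2 * r₂) ^ 2 := by rw [hΔ]; field_simp
        rw [this, ht]; ring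
      have hΔ0 : Δ ≠ 0 := by rintro h; exact hΔsq ⟨0, by rw [h, mul_zero]⟩
      have hε : (0 : ℝ≥0) < normAbs F r₂ * (normAbs F 2 ^ 2 * normAbs F Δ) :=
        mul_pos (pos_iff_ne_zero.2 ((map_ne_zero (normAbs F)).2 hr₂))
          (mul_pos (pow_pos (pos_iff_ne_zero.2 ((map_ne_zero (normAbs F)).2 h2)) 2) (pos_iff_ne_zero.2 ((map_ne_zero (normAbs F)).2 hΔ0)))
      obtain ⟨N, hN⟩ := exists_forall_zpow_two_mul_lt (F := F) hε
      refine ⟨N, fun n hn => ?_⟩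
      have hzero : ∀ σ : F, (primePowBall F (2 * (n : ℤ)) \ primePowBall F (2 * (n : ℤ) + 2)).indicator
          (fun y => Function.extend ((↑) : Fˣ → F) (fun u => ((χ u : ℂˣ) : ℂ)) 0 y * ((((normAbs F y)⁻¹ : ℝ≥0) : ℝ) : ℂ)) (r₀ + r₁ * σ + r₂ * σ ^ 2) = 0 := by
        intro σ
        refine hann0 _ _ fun hmem => ?_
        have hlow : normAbs F r₂ * (normAbs F 2 ^ 2 * normAbs F Δ) ≤ normAbs F (r₀ + r₁ * σ + r₂ * σ ^ 2) := by
          rw [hR, map_mul]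
          refine mul_le_mul_of_nonneg_left ?_ (by positivity)
          exact ((mul_le_mul_of_nonneg_left (le_max_right _ _) (by positivity)).trans (normAbs_sq_sub_ge_of_not_isSquare h2 hΔsq (σ - u)))
        exact not_lt.2 (mem_primePowBall_iff.1 hmem) ((hN n hn).trans_le hlow)
      simp_rw [hzero]
      exact integral_zero _ _

/-- **EVENTUAL CONSTANCY OF THE TRUNCATED CELL INTEGRALS**: with `χ`, `𝔭^β`, `R` as above there is `n₀` such that for all `n ≥ n₀`
`∫_{𝔭^β} 1[R σ ∉ 𝔭^{2n}] χ̃(R σ)‖R σ‖⁻¹ dσ = ∫_{𝔭^β} 1[R σ ∉ 𝔭^{2n₀}] χ̃(R σ)‖R σ‖⁻¹ dσ`.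
[cite: HarishChandra1999AdmissibleDistributions, §7] [cite: LabesseLanglands1979, §2] -/
theorem exists_forall_truncIntegral_eq (h2 : (2 : F) ≠ 0) (χ : QuasiChar F) (hχ2 : ∀ u, χ u * χ u = 1) (hχ1 : ∃ u, χ u ≠ 1)
    (β : ℤ) {r₀ r₁ r₂ : F} (hD : r₁ ^ 2 - 4 * r₀ * r₂ ≠ 0) :
    ∃ n₀ : ℕ, ∀ n : ℕ, n₀ ≤ n →
      ∫ σ in primePowBall F β, (primePowBall F (2 * (n : ℤ)))ᶜ.indicator
        (fun y => Function.extend ((↑) : Fˣ → F) (fun u => ((χ u : ℂˣ) : ℂ)) 0 y * ((((normAbs F y)⁻¹ : ℝ≥0) : ℝ) : ℂ)) (r₀ + r₁ * σ + r₂ * σ ^ 2) ∂μ =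
      ∫ σ in primePowBall F β, (primePowBall F (2 * (n₀ : ℤ)))ᶜ.indicator
        (fun y => Function.extend ((↑) : Fˣ → F) (fun u => ((χ u : ℂˣ) : ℂ)) 0 y * ((((normAbs F y)⁻¹ : ℝ≥0) : ℝ) : ℂ)) (r₀ + r₁ * σ + r₂ * σ ^ 2) ∂μ := by
  haveI : IsTopologicalRing F := inferInstance
  obtain ⟨n₀, hn₀⟩ := exists_forall_annulusIncrement_eq_zero μ h2 χ hχ2 hχ1 β hD
  have hRm : Measurable fun σ : F => r₀ + r₁ * σ + r₂ * σ ^ 2 :=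
    ((continuous_const.add (continuous_const.mul continuous_id)).add (continuous_const.mul (continuous_id.pow 2))).measurable
  refine ⟨n₀, fun n hn => ?_⟩
  induction n, hn using Nat.le_induction with
  | base => rfl
  | succ n hn ih => rw [setIntegral_truncWeight_succ μ χ hχ2 β hRm n, hn₀ n hn, add_zero, ih]

end Main

end Summit.HodgeConjecture.HodgeConjecture.Cruxes.H413.K2E3LocalFieldQuadraticWeightEventuallyConst

end
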